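import Summits.BirchSwinnertonDyer.BirchSwinnertonDyer.Theses.TangentCone
import Summits.BirchSwinnertonDyer.BirchSwinnertonDyer.Theorems.TangentConeEdgeCapUniformReference
import Summits.BirchSwinnertonDyer.BirchSwinnertonDyer.Theorems.TangentConeEdgeCapFibreStrassmann
import Summits.BirchSwinnertonDyer.BirchSwinnertonDyer.Theorems.TangentConeEdgeCapStubContentDivision
import Summits.BirchSwinnertonDyer.BirchSwinnertonDyer.Theorems.TangentConeEdgeCapStubNormOneAddPowSubOne
import Summits.BirchSwinnertonDyer.BirchSwinnertonDyer.Theorems.TangentConeEdgeCapOfFacts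
import Literature.NumberTheory.EllipticCurves.PeriodRationalityCorrectedProofs
import HarnessLib

/-!
# BirchSwinnertonDyer / TangentCone — crux `EdgeCap` (stmt-BirchSwinnertonDyer-17609), line `ratio_measure_strassmann`
# (skeleton v7): stub A2 `stub_arcDivisibility` — TRANSFER from ONE interpolant, and `EdgeCap` from the ∃-form

Stub A2 (the unprinted heart of the crux: order `≥ s_p = corank_{ℤ_p} Sel_{p^∞}(E/ℚ)` along the arc of slope `a/b`, value
form) is registered for EVERY integral two-variable series `F` with non-zero weight-2 fibre satisfying the ratio
interpolation (interp) at all branch members of the progression. `arcDivisibility_of_exists : (∃-form) → (stub A2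
verbatim)` shows, by `p`-adic analysis only, that the arc bound for ONE such interpolant suffices — on paper the ∃-form is
the 2001 two-variable tangent-cone Theorem C for the Greenberg–Stevens function itself (Ochiai's two-variable Euler-system
divisibility over the arc + Mazur–Wiles fullness + control at `(2,1)`), so the transfer removes the "every interpolant"
overhead from whoever proves it; `EdgeCap_of_factsExists : Hida-fact → GS-fact → exists_isNewformOf → (∃-form) → EdgeCap`
(registered colon-form sub-goal stub of the crux item; the ∃-form alone is too long to register) composes it with
`EdgeCap_of_facts` (`TangentConeEdgeCapOfFacts.lean`).

Proof of the transfer (the invariance argument of the line card, kernel-checked). Fix `t ≥ 1`, the member `(k_t, g, ι, s_t)`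
(hypothesis of A2) and divide the vertical zeros out of `F₀ = P·Q` (D `stub_contentDivision`); the proved layers S
(`fibreStrassmann`) and U (`uniformReference`) give `J, C` and, at `x_t`, a reference index `j ≤ 2J+1` with
`‖Q(x_t,y_j)‖ ≥ p^{-C}`. Dichotomy on `‖t‖_p`: if `‖t‖_p ≥ p^{-E'}` (`E' = max(E, J+1)`, `p^{-E} ≤ ‖z‖` for the divided
zeros) the bound is free (`‖F‖ ≤ 1`); otherwise `t ≥ J+1` (so `2j+2 ≤ k_t`), `‖x_t − z‖ = ‖z‖` (T, `‖x_t‖ ≤ ‖t‖_p`) so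
`|P(x_t)| ≥ p^{-E|zs|}`, and the two ratio identities (for `F` and for `F₀`, at the SAME `K_g`-rational ratio
`R = Λ(g,s)/Λ(g,j)`, `hR` by `ratio_completedLValue_mem_coeffField`) give
`‖F(arc t)‖ = ‖ιR‖·‖F(x_t,y_j)‖ ≤ ‖ιR‖ = ‖F₀(arc t)‖/‖F₀(x_t,y_j)‖ ≤ p^{C₀+E|zs|+C}‖t‖^{s_p}`.
The file SUPPORTS stmt-BirchSwinnertonDyer-17609; no definition, no named fact, nothing asserted unconditionally.
-/

-- D-0017: single-problem summit, so `Summit.BirchSwinnertonDyer.BirchSwinnertonDyer.…` repeats a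
-- namespace BY DESIGN.
set_option linter.dupNamespace false

noncomputable section

namespace Summit.BirchSwinnertonDyer.BirchSwinnertonDyer.Theorems

namespace TangentConeEdgeCap

open Summit.BirchSwinnertonDyer.BirchSwinnertonDyer.Theorems.EdgeCap.Negative (norm_one_add_pow_sub_one_lt)

section RatioRationality

open Complex
open Literature.NumberTheory.EllipticCurves.ModularForms

/-- For a newform `g` of even weight `k ≥ 4` on `Γ₀(N)` and odd `0 < s, j < k`, the ratio of completed critical values
`Λ(g,s)/Λ(g,j)` lies in the coefficient field `K_g` (Shimura; Paşol–Popa Cor. 5.12 = tree theorem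
`IsNewform0.criticalValues_petersson_mem_coeffField`): the hypothesis `hR` of `EdgeCap`'s conclusion is inhabited for
every branch member of the progression (`k ≥ 10` even, `s`, `j` odd) — the cap is not vacuous; and by the landed T4
(`IsNewform0.completedLValue_ne_zero_of_two_mul_add_two_lt`, p147781) the denominator `Λ(g,j)` is non-zero for `2j+2 < k`. -/
theorem ratio_completedLValue_mem_coeffField {N : ℕ} [NeZero N] {k : ℤ}
    {g : CuspForm (CongruenceSubgroup.Gamma0 N) k} (hg : IsNewform0 g) (hk : Even k) (hk4 : 4 ≤ k)
    {s j : ℕ} (hs : Odd s) (hj : Odd j) (hsk : (s : ℤ) < k) (hjk : (j : ℤ) < k) :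
    completedLValue g s /
        completedLValue g j ∈ coeffField g := by
  obtain ⟨ωp, ωm, hωp, hωm, hval, -, -, -⟩ := hg.criticalValues_petersson_mem_coeffField hk hk4
  have hkodd : (k - 1).negOnePow = -1 := by
    obtain ⟨r, hr⟩ := hk
    exact Int.negOnePow_odd _ ⟨r - 1, by omega⟩
  have hmem : ∀ n : ℕ, Odd n → (n : ℤ) < k →
      I ^ n * completedLValue g n / ωp ∈ coeffField g := by
    intro n hn hnk
    have hn0 : 0 < n := hn.pos
    refine ((hval n hn0 hnk).1 ?_)
    rw [hkodd]
    obtain ⟨m, rfl⟩ := hn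
    exact Int.negOnePow_odd _ ⟨m, by push_cast; ring⟩
  set Ls := completedLValue g s
  set Lj := completedLValue g j
  have hS := hmem s hs hsk
  have hJ := hmem j hj hjk
  -- `I^s`, `I^j` are `± I`; their quotient is `± 1`
  have hIpow : ∀ n : ℕ, Odd n → I ^ n = I ∨ I ^ n = -I := by
    intro n hn
    obtain ⟨m, rfl⟩ := hn
    rw [pow_add, pow_mul, I_sq, pow_one]
    rcases neg_one_pow_eq_or ℂ m with h | h <;> simp [h]
  by_cases hLj : Lj = 0
  · simp [hLj]
  have hIs0 : I ^ s ≠ 0 := pow_ne_zero _ I_ne_zero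
  have hIj0 : I ^ j ≠ 0 := pow_ne_zero _ I_ne_zero
  -- Ls / Lj = (I^s Ls/ωp) / (I^j Lj/ωp) * (I^j / I^s)
  have hq : Ls / Lj = (I ^ s * Ls / ωp) / (I ^ j * Lj / ωp) * (I ^ j / I ^ s) := by
    field_simp
  rw [hq]
  refine mul_mem (div_mem hS hJ) ?_
  have hunit : I ^ j / I ^ s = 1 ∨ I ^ j / I ^ s = -1 := by
    rcases hIpow s hs with h1 | h1 <;> rcases hIpow j hj with h2 | h2 <;>
      simp [h1, h2, I_ne_zero]
  rcases hunit with h | h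
  · rw [h]; exact one_mem _
  · rw [h]; exact neg_mem (one_mem _)


end RatioRationality

end TangentConeEdgeCap

open Literature.NumberTheory.EllipticCurves Literature.NumberTheory.EllipticCurves.ModularForms
  TangentConeEdgeCap Summit.BirchSwinnertonDyer.BirchSwinnertonDyer.Theorems.EdgeCap.Negative in
/-- **A2 for every interpolant from A2 for one interpolant (transfer).** See the module docstring.
The hypothesis is the ∃-form of the arc divisibility (one integral interpolant with non-zero weight-2
fibre, the ratio interpolation and the arc bound `‖F₀(arc t)‖ ≤ p^{C₀}‖t‖_p^{s_p}`); the conclusion is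
the registered statement of stub A2 `stub_arcDivisibility` of line `ratio_measure_strassmann`, verbatim. -/
theorem arcDivisibility_of_exists (hE :
      ∀ (W : WeierstrassCurve ℚ) [W.IsElliptic] [W.IsGloballyMinimal] (_ : NeZero (W.conductorNorm ℤ)) (p : ℕ) [Fact
      p.Prime], 5 ≤ p → W.HasGoodReductionAtPrime p → ¬ (p : ℤ) ∣ W.frobeniusTrace p → ¬ (p : ℤ) ∣ (W.frobeniusTrace
      p) ^ 2 - 1 → W.HasSurjectiveModNGaloisRep p → (∀ (M : ℕ) (_ : NeZero M) (g : CuspForm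
      (CongruenceSubgroup.Gamma0 M) 2) (ι : Literature.NumberTheory.EllipticCurves.ModularForms.coeffField g →+*
      PadicAlgCl p), M ∣ W.conductorNorm ℤ * p → Literature.NumberTheory.EllipticCurves.ModularForms.IsNewform0 g →
      ‖ι ⟨(UpperHalfPlane.qExpansion 1 ⇑g).coeff p,
      Literature.NumberTheory.EllipticCurves.ModularForms.coeff_mem_coeffField g p⟩‖ = 1 → (∀ ℓ : ℕ, ℓ.Prime → ¬ ℓ ∣
      W.conductorNorm ℤ * p → ‖ι ⟨(UpperHalfPlane.qExpansion 1 ⇑g).coeff ℓ,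
      Literature.NumberTheory.EllipticCurves.ModularForms.coeff_mem_coeffField g ℓ⟩ - ((W.frobeniusTrace ℓ : ℤ) :
      PadicAlgCl p)‖ < 1) → M = W.conductorNorm ℤ ∧ ∀ n : ℕ, (UpperHalfPlane.qExpansion 1 ⇑g).coeff n =
      ((W.LFunction n : ℤ) : ℂ)) → ∀ (a b : ℕ), 0 < b → 2 * a < b → a.Coprime b → (∀ t : ℕ, 0 < t → ∃ (g : CuspForm
      (CongruenceSubgroup.Gamma0 (W.conductorNorm ℤ)) ((2 + 2 * b * (p - 1) * t : ℕ) : ℤ)) (ι :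
      Literature.NumberTheory.EllipticCurves.ModularForms.coeffField g →+* PadicAlgCl p),
      Literature.NumberTheory.EllipticCurves.ModularForms.IsNewform0 g ∧ ‖ι ⟨(UpperHalfPlane.qExpansion 1 ⇑g).coeff
      p, Literature.NumberTheory.EllipticCurves.ModularForms.coeff_mem_coeffField g p⟩‖ = 1 ∧ (∀ ℓ : ℕ, ℓ.Prime → ¬
      ℓ ∣ W.conductorNorm ℤ * p → ‖ι ⟨(UpperHalfPlane.qExpansion 1 ⇑g).coeff ℓ,
      Literature.NumberTheory.EllipticCurves.ModularForms.coeff_mem_coeffField g ℓ⟩ - ((W.frobeniusTrace ℓ : ℤ) :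
      PadicAlgCl p)‖ < 1)) → ∃ F : MvPowerSeries (Fin 2) ℚ_[p], Literature.NumberTheory.EllipticCurves.IsPadicInt F
      ∧ (∃ i : ℕ, MvPowerSeries.coeff (Finsupp.single 1 i) F ≠ 0) ∧ (∀ (k : ℤ) (g : CuspForm
      (CongruenceSubgroup.Gamma0 (W.conductorNorm ℤ)) k) (ι :
      Literature.NumberTheory.EllipticCurves.ModularForms.coeffField g →+* PadicAlgCl p) (s : ℕ), (2 * b * (p - 1) :
      ℤ) ∣ (k - 2) → (b : ℤ) * ((s : ℤ) - 1) = a * (k - 2) →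
      Literature.NumberTheory.EllipticCurves.ModularForms.IsNewform0 g → ‖ι ⟨(UpperHalfPlane.qExpansion 1 ⇑g).coeff
      p, Literature.NumberTheory.EllipticCurves.ModularForms.coeff_mem_coeffField g p⟩‖ = 1 → (∀ ℓ : ℕ, ℓ.Prime → ¬
      ℓ ∣ W.conductorNorm ℤ * p → ‖ι ⟨(UpperHalfPlane.qExpansion 1 ⇑g).coeff ℓ,
      Literature.NumberTheory.EllipticCurves.ModularForms.coeff_mem_coeffField g ℓ⟩ - ((W.frobeniusTrace ℓ : ℤ) :
      PadicAlgCl p)‖ < 1) → ∀ j : ℕ, Odd j → 3 ≤ j → (p - 1) ∣ (j - 1) → 2 * (j : ℤ) + 2 ≤ k →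
      Literature.NumberTheory.EllipticCurves.padicEval₂ F ((1 + (p : ℚ_[p])) ^ (k - 2) - 1) ((1 + (p : ℚ_[p])) ^ (j
      - 1) - 1) ≠ 0 ∧ ∀ hR : (∫ t in Set.Ioi (0 : ℝ), ((t : ℂ) ^ (s - 1)) * g (UpperHalfPlane.ofComplex ((t : ℂ) *
      Complex.I))) / (∫ t in Set.Ioi (0 : ℝ), ((t : ℂ) ^ (j - 1)) * g (UpperHalfPlane.ofComplex ((t : ℂ) *
      Complex.I))) ∈ Literature.NumberTheory.EllipticCurves.ModularForms.coeffField g, ‖ι ⟨_, hR⟩‖ *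
      ‖Literature.NumberTheory.EllipticCurves.padicEval₂ F ((1 + (p : ℚ_[p])) ^ (k - 2) - 1) ((1 + (p : ℚ_[p])) ^ (j
      - 1) - 1)‖ = ‖Literature.NumberTheory.EllipticCurves.padicEval₂ F ((1 + (p : ℚ_[p])) ^ (k - 2) - 1) ((1 + (p :
      ℚ_[p])) ^ (s - 1) - 1)‖) ∧ ∃ C₀ : ℕ, ∀ t : ℕ, 0 < t → ‖Literature.NumberTheory.EllipticCurves.padicEval₂ F ((1
      + (p : ℚ_[p])) ^ (2 * b * (p - 1) * t) - 1) ((1 + (p : ℚ_[p])) ^ (2 * a * (p - 1) * t) - 1)‖ ≤ (p : ℝ) ^ C₀ *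
      ‖(t : ℚ_[p])‖ ^ W.selmerCorank p) :
      ∀ (W : WeierstrassCurve ℚ) [W.IsElliptic] [W.IsGloballyMinimal] (_ : NeZero (W.conductorNorm ℤ)) (p : ℕ) [Fact
      p.Prime], 5 ≤ p → W.HasGoodReductionAtPrime p → ¬ (p : ℤ) ∣ W.frobeniusTrace p → ¬ (p : ℤ) ∣ (W.frobeniusTrace
      p) ^ 2 - 1 → W.HasSurjectiveModNGaloisRep p → (∀ (M : ℕ) (_ : NeZero M) (g : CuspForm
      (CongruenceSubgroup.Gamma0 M) 2) (ι : Literature.NumberTheory.EllipticCurves.ModularForms.coeffField g →+*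
      PadicAlgCl p), M ∣ W.conductorNorm ℤ * p → Literature.NumberTheory.EllipticCurves.ModularForms.IsNewform0 g →
      ‖ι ⟨(UpperHalfPlane.qExpansion 1 ⇑g).coeff p,
      Literature.NumberTheory.EllipticCurves.ModularForms.coeff_mem_coeffField g p⟩‖ = 1 → (∀ ℓ : ℕ, ℓ.Prime → ¬ ℓ ∣
      W.conductorNorm ℤ * p → ‖ι ⟨(UpperHalfPlane.qExpansion 1 ⇑g).coeff ℓ,
      Literature.NumberTheory.EllipticCurves.ModularForms.coeff_mem_coeffField g ℓ⟩ - ((W.frobeniusTrace ℓ : ℤ) :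
      PadicAlgCl p)‖ < 1) → M = W.conductorNorm ℤ ∧ ∀ n : ℕ, (UpperHalfPlane.qExpansion 1 ⇑g).coeff n =
      ((W.LFunction n : ℤ) : ℂ)) → ∀ (a b : ℕ), 0 < b → 2 * a < b → a.Coprime b → ∀ F : MvPowerSeries (Fin 2) ℚ_[p],
      Literature.NumberTheory.EllipticCurves.IsPadicInt F → (∃ i : ℕ, MvPowerSeries.coeff (Finsupp.single 1 i) F ≠
      0) → (∀ (k : ℤ) (g : CuspForm (CongruenceSubgroup.Gamma0 (W.conductorNorm ℤ)) k) (ι :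
      Literature.NumberTheory.EllipticCurves.ModularForms.coeffField g →+* PadicAlgCl p) (s : ℕ), (2 * b * (p - 1) :
      ℤ) ∣ (k - 2) → (b : ℤ) * ((s : ℤ) - 1) = a * (k - 2) →
      Literature.NumberTheory.EllipticCurves.ModularForms.IsNewform0 g → ‖ι ⟨(UpperHalfPlane.qExpansion 1 ⇑g).coeff
      p, Literature.NumberTheory.EllipticCurves.ModularForms.coeff_mem_coeffField g p⟩‖ = 1 → (∀ ℓ : ℕ, ℓ.Prime → ¬
      ℓ ∣ W.conductorNorm ℤ * p → ‖ι ⟨(UpperHalfPlane.qExpansion 1 ⇑g).coeff ℓ,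
      Literature.NumberTheory.EllipticCurves.ModularForms.coeff_mem_coeffField g ℓ⟩ - ((W.frobeniusTrace ℓ : ℤ) :
      PadicAlgCl p)‖ < 1) → ∀ j : ℕ, Odd j → 3 ≤ j → (p - 1) ∣ (j - 1) → 2 * (j : ℤ) + 2 ≤ k →
      Literature.NumberTheory.EllipticCurves.padicEval₂ F ((1 + (p : ℚ_[p])) ^ (k - 2) - 1) ((1 + (p : ℚ_[p])) ^ (j
      - 1) - 1) ≠ 0 ∧ ∀ hR : (∫ t in Set.Ioi (0 : ℝ), ((t : ℂ) ^ (s - 1)) * g (UpperHalfPlane.ofComplex ((t : ℂ) *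
      Complex.I))) / (∫ t in Set.Ioi (0 : ℝ), ((t : ℂ) ^ (j - 1)) * g (UpperHalfPlane.ofComplex ((t : ℂ) *
      Complex.I))) ∈ Literature.NumberTheory.EllipticCurves.ModularForms.coeffField g, ‖ι ⟨_, hR⟩‖ *
      ‖Literature.NumberTheory.EllipticCurves.padicEval₂ F ((1 + (p : ℚ_[p])) ^ (k - 2) - 1) ((1 + (p : ℚ_[p])) ^ (j
      - 1) - 1)‖ = ‖Literature.NumberTheory.EllipticCurves.padicEval₂ F ((1 + (p : ℚ_[p])) ^ (k - 2) - 1) ((1 + (p :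
      ℚ_[p])) ^ (s - 1) - 1)‖) → (∀ t : ℕ, 0 < t → ∃ (g : CuspForm (CongruenceSubgroup.Gamma0 (W.conductorNorm ℤ))
      ((2 + 2 * b * (p - 1) * t : ℕ) : ℤ)) (ι : Literature.NumberTheory.EllipticCurves.ModularForms.coeffField g →+*
      PadicAlgCl p), Literature.NumberTheory.EllipticCurves.ModularForms.IsNewform0 g ∧ ‖ι
      ⟨(UpperHalfPlane.qExpansion 1 ⇑g).coeff p,
      Literature.NumberTheory.EllipticCurves.ModularForms.coeff_mem_coeffField g p⟩‖ = 1 ∧ (∀ ℓ : ℕ, ℓ.Prime → ¬ ℓ ∣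
      W.conductorNorm ℤ * p → ‖ι ⟨(UpperHalfPlane.qExpansion 1 ⇑g).coeff ℓ,
      Literature.NumberTheory.EllipticCurves.ModularForms.coeff_mem_coeffField g ℓ⟩ - ((W.frobeniusTrace ℓ : ℤ) :
      PadicAlgCl p)‖ < 1)) → ∃ C₀ : ℕ, ∀ t : ℕ, 0 < t → ‖Literature.NumberTheory.EllipticCurves.padicEval₂ F ((1 +
      (p : ℚ_[p])) ^ (2 * b * (p - 1) * t) - 1) ((1 + (p : ℚ_[p])) ^ (2 * a * (p - 1) * t) - 1)‖ ≤ (p : ℝ) ^ C₀ *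
      ‖(t : ℚ_[p])‖ ^ W.selmerCorank p := by
  intro W _ _ hN p _ h5 hgood hord hna hsurj hBr a b hb hab hcop F hFi hwt2 hinterp hmem
  obtain ⟨F₀, hF₀i, hwt2₀, hinterp₀, C₀, harc₀⟩ := hE W hN p h5 hgood hord hna hsurj hBr a b hb hab hcop hmem
  have hp1 : (1 : ℝ) < p := by exact_mod_cast (Fact.out : p.Prime).one_lt
  have hp1' : (1 : ℝ) ≤ (p : ℝ) := hp1.le
  have hp0 : (0 : ℝ) ≤ (p : ℝ) := le_trans zero_le_one hp1'
  have hp5 : 1 ≤ p := by omega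
  -- analysis on `F₀`: content division, Strassmann, uniform reference, size of the divided zeros
  obtain ⟨Q, zs, hQi, hzs, hfac, hQvert⟩ :=
    Summit.BirchSwinnertonDyer.BirchSwinnertonDyer.Theorems.stub_contentDivision p F₀ hF₀i hwt2₀
  obtain ⟨J, C, href⟩ := uniformReference p Q hQi (fibreStrassmann p Q hQi hQvert)
  obtain ⟨E, hE'⟩ := exists_pow_neg_le_norm_of_list zs fun z hz => (hzs z hz).1
  set sp : ℕ := W.selmerCorank p with hsp
  set E' : ℕ := max E (J + 1) with hE'def
  refine ⟨C₀ + E * zs.length + C + E' * sp, fun t ht => ?_⟩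
  have ht0 : t ≠ 0 := Nat.pos_iff_ne_zero.mp ht
  -- the arc point
  set x : ℚ_[p] := (1 + (p : ℚ_[p])) ^ (2 * b * (p - 1) * t) - 1 with hxdef
  set ys : ℚ_[p] := (1 + (p : ℚ_[p])) ^ (2 * a * (p - 1) * t) - 1 with hysdef
  have hx : ‖x‖ < 1 := norm_one_add_pow_sub_one_lt p _
  have hys : ‖ys‖ < 1 := norm_one_add_pow_sub_one_lt p _
  have hxt : ‖x‖ ≤ ‖(t : ℚ_[p])‖ := by
    refine (Summit.BirchSwinnertonDyer.BirchSwinnertonDyer.Theorems.stub_normOneAddPowSubOne p (by omega)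
      (2 * b * (p - 1) * t)).trans ?_
    have h2 : ‖((2 * b * (p - 1) * t : ℕ) : ℚ_[p])‖ ≤ ‖(t : ℚ_[p])‖ := by
      have : ((2 * b * (p - 1) * t : ℕ) : ℚ_[p]) = ((2 * b * (p - 1) : ℕ) : ℚ_[p]) * (t : ℚ_[p]) := by push_cast; ring
      rw [this, norm_mul]
      refine mul_le_of_le_one_left (norm_nonneg _) ?_
      simpa using Padic.norm_int_le_one (p := p) ((2 * b * (p - 1) : ℕ) : ℤ)
    calc ‖(p : ℚ_[p])‖ * ‖((2 * b * (p - 1) * t : ℕ) : ℚ_[p])‖ ≤ 1 * ‖(t : ℚ_[p])‖ := by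
          gcongr
          simpa using Padic.norm_int_le_one (p := p) (p : ℤ)
      _ = ‖(t : ℚ_[p])‖ := one_mul _
  have hFs1 : ‖padicEval₂ F x ys‖ ≤ 1 := norm_padicEval₂_le_one hFi hx hys
  have hτ0 : 0 < ‖(t : ℚ_[p])‖ := norm_pos_iff.mpr (by exact_mod_cast ht0)
  by_cases hcase : ((p : ℝ) ^ E')⁻¹ ≤ ‖(t : ℚ_[p])‖
  · -- free bound
    have h1 : (1 : ℝ) ≤ (p : ℝ) ^ (E' * sp) * ‖(t : ℚ_[p])‖ ^ sp := by
      rw [pow_mul, ← mul_pow]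
      exact one_le_pow₀ ((inv_le_iff_one_le_mul₀' (by positivity)).mp hcase)
    calc ‖padicEval₂ F x ys‖ ≤ 1 := hFs1
      _ ≤ (p : ℝ) ^ (E' * sp) * ‖(t : ℚ_[p])‖ ^ sp := h1
      _ ≤ (p : ℝ) ^ (C₀ + E * zs.length + C + E' * sp) * ‖(t : ℚ_[p])‖ ^ sp :=
          mul_le_mul_of_nonneg_right (pow_le_pow_right₀ hp1' (by omega)) (by positivity)
  · push Not at hcase
    -- `t` is `p`-adically small, hence large as an integer: `t ≥ J + 1`
    have hval1 : ‖(t : ℚ_[p])‖ * (p : ℝ) ^ padicValNat p t = 1 := norm_natCast_mul_pow_padicValNat p ht0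
    have htJ : J + 1 ≤ t := by
      by_contra hlt
      push Not at hlt
      have hv : p ^ padicValNat p t ≤ t := Nat.le_of_dvd ht pow_padicValNat_dvd
      have hvlt : padicValNat p t < p ^ padicValNat p t := Nat.lt_pow_self (Fact.out : p.Prime).one_lt
      have hvE : padicValNat p t + 1 ≤ E' := by have := le_max_right E (J + 1); omega
      -- ‖t‖ = (p^v)⁻¹ ≥ (p^{E'})⁻¹
      have hnorm : ‖(t : ℚ_[p])‖ = ((p : ℝ) ^ padicValNat p t)⁻¹ := eq_inv_of_mul_eq_one_left hval1
      have : ((p : ℝ) ^ E')⁻¹ ≤ ((p : ℝ) ^ padicValNat p t)⁻¹ := by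
        rw [inv_le_inv₀ (by positivity) (by positivity)]
        exact pow_le_pow_right₀ hp1' (by omega)
      rw [← hnorm] at this
      exact absurd this (not_le.mpr hcase)
    -- the member at weight `k_t` (generalise the weight to a variable `k`)
    obtain ⟨g, ι, hnew, hordg, hcong⟩ := hmem t ht
    revert g
    generalize hkdef' : ((2 + 2 * b * (p - 1) * t : ℕ) : ℤ) = k
    intro g ι hnew hordg hcong
    have hkdef : k = ((2 + 2 * b * (p - 1) * t : ℕ) : ℤ) := hkdef'.symm
    have hkt : k - 2 = ((2 * b * (p - 1) * t : ℕ) : ℤ) := by rw [hkdef]; push_cast; ring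
    have hbig : 8 * (J + 1) ≤ 2 * b * (p - 1) * t := by
      have h1 : 2 * 1 * 4 * (J + 1) ≤ 2 * b * (p - 1) * t := Nat.mul_le_mul (Nat.mul_le_mul (Nat.mul_le_mul_left 2 hb) (by omega)) htJ
      omega
    -- reference index at `x`
    obtain ⟨j, hjodd, hj3, hjp, hjJ, hlow⟩ := href x hx
    have hjk : 2 * (j : ℤ) + 2 ≤ k := by
      rw [hkdef]; push_cast
      have : (j : ℤ) ≤ 2 * J + 1 := by exact_mod_cast hjJ
      have hbig' : (8 * (J + 1) : ℤ) ≤ ((2 * b * (p - 1) * t : ℕ) : ℤ) := by exact_mod_cast hbig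
      push_cast [Nat.cast_sub hp5] at hbig'
      push_cast [Nat.cast_sub hp5]
      omega
    -- progression hypotheses of (interp)
    have hdiv : (2 * (b : ℕ) * (p - 1) : ℤ) ∣ (k - 2) := ⟨t, by rw [hkt]; push_cast [Nat.cast_sub hp5]; ring⟩
    set s : ℕ := 1 + 2 * a * (p - 1) * t with hsdef
    have hs1 : s - 1 = 2 * a * (p - 1) * t := by omega
    have hs : ((b : ℕ) : ℤ) * ((s : ℤ) - 1) = (a : ℕ) * (k - 2) := by
      rw [hkt, hsdef]; push_cast; ring
    obtain ⟨hFne, hratio⟩ := hinterp k g ι s hdiv hs hnew hordg hcong j hjodd hj3 hjp hjk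
    obtain ⟨hF₀ne, hratio₀⟩ := hinterp₀ k g ι s hdiv hs hnew hordg hcong j hjodd hj3 hjp hjk
    -- the `K_g`-rationality of the ratio (Shimura / Paşol–Popa)
    have hk4 : (4 : ℤ) ≤ k := by omega
    have hkeven : Even k := ⟨1 + (b : ℤ) * (p - 1 : ℕ) * t, by rw [hkdef]; push_cast; ring⟩
    have hsodd : Odd s := ⟨a * (p - 1) * t, by rw [hsdef]; ring⟩
    have hsk : (s : ℤ) < k := by
      rw [hkdef, hsdef]; push_cast
      have hab' : 2 * a ≤ b := hab.le
      have : 2 * a * (p - 1) * t ≤ b * (p - 1) * t := Nat.mul_le_mul_right t (Nat.mul_le_mul_right (p - 1) hab')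
      have : ((2 * a * (p - 1) * t : ℕ) : ℤ) ≤ ((b * (p - 1) * t : ℕ) : ℤ) := by exact_mod_cast this
      push_cast [Nat.cast_sub hp5] at this
      have hpos : (0 : ℤ) < (b : ℤ) * ((p : ℤ) - 1) * t :=
        mul_pos (mul_pos (by exact_mod_cast hb) (by omega)) (by exact_mod_cast ht)
      push_cast [Nat.cast_sub hp5]
      nlinarith
    have hjk' : (j : ℤ) < k := by omega
    have hR : completedLValue g s / completedLValue g j ∈ coeffField g :=
      ratio_completedLValue_mem_coeffField hnew hkeven hk4 hsodd hjodd hsk hjk'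
    specialize hratio hR
    specialize hratio₀ hR
    -- rewrite the points of (interp) into the arc coordinates
    have hxk : (1 + (p : ℚ_[p])) ^ (k - 2) - 1 = x := by rw [hxdef, hkt, zpow_natCast]
    have hysEq : (1 + (p : ℚ_[p])) ^ (s - 1) - 1 = ys := by rw [hysdef, hs1]
    rw [hxk] at hratio hratio₀ hFne hF₀ne
    rw [hysEq] at hratio hratio₀
    set yj : ℚ_[p] := (1 + (p : ℚ_[p])) ^ (j - 1) - 1 with hyjdef
    have hyj : ‖yj‖ < 1 := norm_one_add_pow_sub_one_lt p _
    -- factorisation of `F₀` at the two points and the size of `P(x)`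
    set P : ℚ_[p] := (zs.map fun z => x - z).prod with hPdef
    have hfacj : padicEval₂ F₀ x yj = P * padicEval₂ Q x yj := hfac x yj hx hyj
    have hcaseE : ‖(t : ℚ_[p])‖ < ((p : ℝ) ^ E)⁻¹ := by
      refine hcase.trans_le ?_
      rw [inv_le_inv₀ (by positivity) (by positivity)]
      exact pow_le_pow_right₀ hp1' (le_max_left _ _)
    have hxz : ∀ z ∈ zs, ‖x - z‖ = ‖z‖ := by
      intro z hz
      have hlt : ‖x‖ < ‖z‖ := lt_of_le_of_lt hxt (hcaseE.trans_le (hE' z hz))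
      have h := Padic.norm_eq_of_norm_sub_lt_right (z1 := x - z) (z2 := -z)
        (by rw [sub_neg_eq_add, sub_add_cancel, norm_neg]; exact hlt)
      rwa [norm_neg] at h
    have hPge : ((p : ℝ) ^ (E * zs.length))⁻¹ ≤ ‖P‖ := by
      rw [hPdef, pow_mul, ← inv_pow]
      exact pow_length_le_norm_prod_map_sub (by positivity) zs fun z hz => by
        rw [hxz z hz]; exact hE' z hz
    have hPpos : 0 < ‖P‖ := lt_of_lt_of_le (by positivity) hPge
    -- lower bound for the reference value of `F₀`
    have hQlow : ((p : ℝ) ^ C)⁻¹ ≤ ‖padicEval₂ Q x yj‖ := by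
      rw [inv_le_iff_one_le_mul₀' (by positivity)]
      simpa [mul_comm] using hlow
    have hF₀low : ((p : ℝ) ^ (E * zs.length))⁻¹ * ((p : ℝ) ^ C)⁻¹ ≤ ‖padicEval₂ F₀ x yj‖ := by
      rw [hfacj, norm_mul]
      exact mul_le_mul hPge hQlow (by positivity) (norm_nonneg _)
    have hF₀pos : 0 < ‖padicEval₂ F₀ x yj‖ := lt_of_lt_of_le (by positivity) hF₀low
    -- the ratio `y = ‖ιR‖` from the two identities
    set y : ℝ := ‖ι ⟨_, hR⟩‖ with hy
    have hy0 : 0 ≤ y := norm_nonneg _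
    have hyeq : y = ‖padicEval₂ F₀ x ys‖ / ‖padicEval₂ F₀ x yj‖ := by
      rw [eq_div_iff hF₀pos.ne']
      exact hratio₀
    have harcF₀ : ‖padicEval₂ F₀ x ys‖ ≤ (p : ℝ) ^ C₀ * ‖(t : ℚ_[p])‖ ^ sp := harc₀ t ht
    -- assembly
    have hyle : y ≤ (p : ℝ) ^ (C₀ + E * zs.length + C) * ‖(t : ℚ_[p])‖ ^ sp := by
      rw [hyeq, div_le_iff₀ hF₀pos]
      have hA : (p : ℝ) ^ (E * zs.length) ≠ 0 := by positivity
      have hB : (p : ℝ) ^ C ≠ 0 := by positivity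
      calc ‖padicEval₂ F₀ x ys‖ ≤ (p : ℝ) ^ C₀ * ‖(t : ℚ_[p])‖ ^ sp := harcF₀
        _ = (p : ℝ) ^ (C₀ + E * zs.length + C) * ‖(t : ℚ_[p])‖ ^ sp *
              (((p : ℝ) ^ (E * zs.length))⁻¹ * ((p : ℝ) ^ C)⁻¹) := by
            rw [pow_add, pow_add]
            field_simp
        _ ≤ (p : ℝ) ^ (C₀ + E * zs.length + C) * ‖(t : ℚ_[p])‖ ^ sp * ‖padicEval₂ F₀ x yj‖ :=
            mul_le_mul_of_nonneg_left hF₀low (by positivity)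
    calc ‖padicEval₂ F x ys‖ = y * ‖padicEval₂ F x yj‖ := hratio.symm
      _ ≤ y * 1 := mul_le_mul_of_nonneg_left (norm_padicEval₂_le_one hFi hx hyj) hy0
      _ = y := mul_one _
      _ ≤ (p : ℝ) ^ (C₀ + E * zs.length + C) * ‖(t : ℚ_[p])‖ ^ sp := hyle
      _ ≤ (p : ℝ) ^ (C₀ + E * zs.length + C + E' * sp) * ‖(t : ℚ_[p])‖ ^ sp :=
          mul_le_mul_of_nonneg_right (pow_le_pow_right₀ hp1' (by omega)) (by positivity)

open Summit.BirchSwinnertonDyer.BirchSwinnertonDyer.Theses.TangentCone in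
/-- **`EdgeCap` from the ∃-form of the arc divisibility and three named facts** (registered colon form,
sub-goal stub `EdgeCap_of_factsExists` of stmt-BirchSwinnertonDyer-17609): Hida's members, the
Greenberg–Stevens/Kitagawa interpolation and modularity reduce the crux `TangentCone.EdgeCap` to the arc bound
for ONE interpolant (`arcDivisibility_of_exists` then `EdgeCap_of_facts`). [cite: GreenbergStevens1993, Thm 5.15]
[cite: Hida1986] -/
theorem EdgeCap_of_factsExists :
    Literature.NumberTheory.EllipticCurves.hida_exists_congruent_ordinary_newform →
    Literature.NumberTheory.EllipticCurves.greenbergStevens_kitagawa_twoVariable_interpolation →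
    Literature.NumberTheory.EllipticCurves.ModularForms.exists_isNewformOf →
    (∀ (W : WeierstrassCurve ℚ) [W.IsElliptic] [W.IsGloballyMinimal] (_ : NeZero (W.conductorNorm ℤ)) (p : ℕ) [Fact
      p.Prime], 5 ≤ p → W.HasGoodReductionAtPrime p → ¬ (p : ℤ) ∣ W.frobeniusTrace p → ¬ (p : ℤ) ∣ (W.frobeniusTrace
      p) ^ 2 - 1 → W.HasSurjectiveModNGaloisRep p → (∀ (M : ℕ) (_ : NeZero M) (g : CuspForm
      (CongruenceSubgroup.Gamma0 M) 2) (ι : Literature.NumberTheory.EllipticCurves.ModularForms.coeffField g →+*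
      PadicAlgCl p), M ∣ W.conductorNorm ℤ * p → Literature.NumberTheory.EllipticCurves.ModularForms.IsNewform0 g →
      ‖ι ⟨(UpperHalfPlane.qExpansion 1 ⇑g).coeff p,
      Literature.NumberTheory.EllipticCurves.ModularForms.coeff_mem_coeffField g p⟩‖ = 1 → (∀ ℓ : ℕ, ℓ.Prime → ¬ ℓ ∣
      W.conductorNorm ℤ * p → ‖ι ⟨(UpperHalfPlane.qExpansion 1 ⇑g).coeff ℓ,
      Literature.NumberTheory.EllipticCurves.ModularForms.coeff_mem_coeffField g ℓ⟩ - ((W.frobeniusTrace ℓ : ℤ) :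
      PadicAlgCl p)‖ < 1) → M = W.conductorNorm ℤ ∧ ∀ n : ℕ, (UpperHalfPlane.qExpansion 1 ⇑g).coeff n =
      ((W.LFunction n : ℤ) : ℂ)) → ∀ (a b : ℕ), 0 < b → 2 * a < b → a.Coprime b → (∀ t : ℕ, 0 < t → ∃ (g : CuspForm
      (CongruenceSubgroup.Gamma0 (W.conductorNorm ℤ)) ((2 + 2 * b * (p - 1) * t : ℕ) : ℤ)) (ι :
      Literature.NumberTheory.EllipticCurves.ModularForms.coeffField g →+* PadicAlgCl p),
      Literature.NumberTheory.EllipticCurves.ModularForms.IsNewform0 g ∧ ‖ι ⟨(UpperHalfPlane.qExpansion 1 ⇑g).coeff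
      p, Literature.NumberTheory.EllipticCurves.ModularForms.coeff_mem_coeffField g p⟩‖ = 1 ∧ (∀ ℓ : ℕ, ℓ.Prime → ¬
      ℓ ∣ W.conductorNorm ℤ * p → ‖ι ⟨(UpperHalfPlane.qExpansion 1 ⇑g).coeff ℓ,
      Literature.NumberTheory.EllipticCurves.ModularForms.coeff_mem_coeffField g ℓ⟩ - ((W.frobeniusTrace ℓ : ℤ) :
      PadicAlgCl p)‖ < 1)) → ∃ F : MvPowerSeries (Fin 2) ℚ_[p], Literature.NumberTheory.EllipticCurves.IsPadicInt F
      ∧ (∃ i : ℕ, MvPowerSeries.coeff (Finsupp.single 1 i) F ≠ 0) ∧ (∀ (k : ℤ) (g : CuspForm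
      (CongruenceSubgroup.Gamma0 (W.conductorNorm ℤ)) k) (ι :
      Literature.NumberTheory.EllipticCurves.ModularForms.coeffField g →+* PadicAlgCl p) (s : ℕ), (2 * b * (p - 1) :
      ℤ) ∣ (k - 2) → (b : ℤ) * ((s : ℤ) - 1) = a * (k - 2) →
      Literature.NumberTheory.EllipticCurves.ModularForms.IsNewform0 g → ‖ι ⟨(UpperHalfPlane.qExpansion 1 ⇑g).coeff
      p, Literature.NumberTheory.EllipticCurves.ModularForms.coeff_mem_coeffField g p⟩‖ = 1 → (∀ ℓ : ℕ, ℓ.Prime → ¬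
      ℓ ∣ W.conductorNorm ℤ * p → ‖ι ⟨(UpperHalfPlane.qExpansion 1 ⇑g).coeff ℓ,
      Literature.NumberTheory.EllipticCurves.ModularForms.coeff_mem_coeffField g ℓ⟩ - ((W.frobeniusTrace ℓ : ℤ) :
      PadicAlgCl p)‖ < 1) → ∀ j : ℕ, Odd j → 3 ≤ j → (p - 1) ∣ (j - 1) → 2 * (j : ℤ) + 2 ≤ k →
      Literature.NumberTheory.EllipticCurves.padicEval₂ F ((1 + (p : ℚ_[p])) ^ (k - 2) - 1) ((1 + (p : ℚ_[p])) ^ (j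
      - 1) - 1) ≠ 0 ∧ ∀ hR : (∫ t in Set.Ioi (0 : ℝ), ((t : ℂ) ^ (s - 1)) * g (UpperHalfPlane.ofComplex ((t : ℂ) *
      Complex.I))) / (∫ t in Set.Ioi (0 : ℝ), ((t : ℂ) ^ (j - 1)) * g (UpperHalfPlane.ofComplex ((t : ℂ) *
      Complex.I))) ∈ Literature.NumberTheory.EllipticCurves.ModularForms.coeffField g, ‖ι ⟨_, hR⟩‖ *
      ‖Literature.NumberTheory.EllipticCurves.padicEval₂ F ((1 + (p : ℚ_[p])) ^ (k - 2) - 1) ((1 + (p : ℚ_[p])) ^ (j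
      - 1) - 1)‖ = ‖Literature.NumberTheory.EllipticCurves.padicEval₂ F ((1 + (p : ℚ_[p])) ^ (k - 2) - 1) ((1 + (p :
      ℚ_[p])) ^ (s - 1) - 1)‖) ∧ ∃ C₀ : ℕ, ∀ t : ℕ, 0 < t → ‖Literature.NumberTheory.EllipticCurves.padicEval₂ F ((1
      + (p : ℚ_[p])) ^ (2 * b * (p - 1) * t) - 1) ((1 + (p : ℚ_[p])) ^ (2 * a * (p - 1) * t) - 1)‖ ≤ (p : ℝ) ^ C₀ *
      ‖(t : ℚ_[p])‖ ^ W.selmerCorank p) →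
    Summit.BirchSwinnertonDyer.BirchSwinnertonDyer.Theses.TangentCone.EdgeCap :=
  fun hHida hGS hmod hE => EdgeCap_of_facts hHida hGS hmod (arcDivisibility_of_exists hE)
end Summit.BirchSwinnertonDyer.BirchSwinnertonDyer.Theorems

end
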